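import Summits.AtomisticToContinuum.Crystallization.Theorems.ChartedZeroExcessLayeredLatticeLiouvilleZZW

/-!
# Charted zero-excess layered lattices — Part ZZX: STEERING WALKS for rider R1 (window connectivity, part 1 of 3)

Route `ChartedPlanarOrder`, station L2′, lineage `stmt-AtomisticToContinuum-26636`; sequel of Parts ZZU (skeleton), ZZV (R2-S),
ZZW (R2-C).  Rider R1 `WindowConnected S K Ψ τ` asks that the mid window `W = window (81/8) (155/8)` and the deep window
`W′ = window (179/16) (293/16)` (shells of the POTENTIAL `φ = d(Ψ ·, K)`) are each connected under Barlow steps inside themselves.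
NO SHEET FLATNESS is used anywhere: the only geometric input is «an atom toward any direction» (`exists_atom_toward`, Part ZZD:
at a `(1/16, 9/10, 1)`-clean atom there is a bonded atom in every `60°` cone), pulled back through the S-chart to a Barlow step
(`exists_barlowAdj_toward`).  This part supplies the WALKS; Part ZZY supplies the level surface `{φ = M}` and the direction
chains; Part ZZZ the LEG along a chain of level points and the assembly of R1 (★★ `windowConnected`).

* ZZX-1 `exists_path_to_goal` — GENERIC FINITE DESCENT: if every non-goal site of `V` has an `R`-successor in `V` with strictly
  smaller real potential and `V` lies in a finite set, every site of `V` is joined inside `V` to a goal site.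
* ZZX-2 `exists_barlowAdj_toward` — the chart pull-back of `exists_atom_toward`.
* ZZX-3 window membership ⇄ potential (`mem_window_of_infDist`, `infDist_bounds_of_mem_window`).
* ZZX-4 `dist_lt_dist_of_inward` / `infDist_lt_infDist_of_inward` — an INWARD cone step (toward `x₀`, from radius `≥ 10`)
  strictly DECREASES the potential (the outward twin is Part ZZT's `infDist_lt_infDist_of_cone`).
* ZZX-5 `exists_path_up` / `exists_path_down` / ★ `exists_path_to_band` — from any window site a Barlow path INSIDE the window
  to a site with potential in the band `(M, M + 17/16]` (dials `8 ≤ lo ≤ M`, `14 ≤ M`, `M + 17/16 < hi ≤ 43/2`; record `M = 71/5`).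
* ZZX-6 ★ `exists_path_toward_point` — GREEDY WALK: from a window site within `L` of a point `t` with `lo + L ≤ φ(t)`,
  `φ(t) + L ≤ hi`, a Barlow path inside the window to a site within `17/16` of `t` (the distance to `t` strictly decreases
  while it exceeds one bond; the path stays in `B(t, L)`).

0 sorry; standard axioms; no decide; no definitions.
-/

noncomputable section
open scoped RealInnerProductSpace
open Literature.Geometry.DiscreteGeometry (IsTwoShellGoodSet)
open Summit.AtomisticToContinuum.Crystallization.Theorems.ChartedPlanarOrderRigidityDoor (E3)

namespace Summit.AtomisticToContinuum.Crystallization.Theorems.ChartedZeroExcessLayeredLatticeLiouville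

/-! ### ZZX-1  Generic finite descent -/

/-- ★ GENERIC FINITE DESCENT TO A GOAL.  [formal bookkeeping] -/
theorem exists_path_to_goal {α : Type*} (R : α → α → Prop) (V : Set α) (Goal : α → Prop) (F : α → ℝ)
    (T : Finset α) (hT : ∀ x ∈ V, x ∈ T)
    (hstep : ∀ x ∈ V, ¬ Goal x → ∃ x', x' ∈ V ∧ R x x' ∧ F x' < F x) :
    ∀ x ∈ V, ∃ z ∈ V, Goal z ∧ Relation.ReflTransGen R x z := by
  classical
  suffices h : ∀ n : ℕ, ∀ x ∈ V, (T.filter fun w => F w < F x).card ≤ n →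
      ∃ z ∈ V, Goal z ∧ Relation.ReflTransGen R x z from fun x hx => h _ x hx le_rfl
  intro n
  induction n with
  | zero =>
    intro x hx hcard
    by_cases hg : Goal x
    · exact ⟨x, hx, hg, Relation.ReflTransGen.refl⟩
    · obtain ⟨x', hx', -, hF⟩ := hstep x hx hg
      have hmem : x' ∈ T.filter fun w => F w < F x := Finset.mem_filter.2 ⟨hT x' hx', hF⟩
      have := Finset.card_pos.2 ⟨x', hmem⟩
      omega
  | succ n ih =>
    intro x hx hcard
    by_cases hg : Goal x
    · exact ⟨x, hx, hg, Relation.ReflTransGen.refl⟩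
    · obtain ⟨x', hx', hR, hF⟩ := hstep x hx hg
      have hsub : (T.filter fun w => F w < F x') ⊆ (T.filter fun w => F w < F x) := by
        intro w hw
        rw [Finset.mem_filter] at hw ⊢
        exact ⟨hw.1, hw.2.trans hF⟩
      have hss : (T.filter fun w => F w < F x') ⊂ (T.filter fun w => F w < F x) :=
        (Finset.ssubset_iff_of_subset hsub).2
          ⟨x', Finset.mem_filter.2 ⟨hT x' hx', hF⟩, fun h => lt_irrefl _ (Finset.mem_filter.1 h).2⟩
      have hlt := Finset.card_lt_card hss
      obtain ⟨z, hz, hgz, hpath⟩ := ih x' hx' (by omega)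
      exact ⟨z, hz, hgz, Relation.ReflTransGen.head hR hpath⟩

/-- paths of a symmetric relation reverse. [formal bookkeeping] -/
theorem reflTransGen_reverse {α : Type*} {R : α → α → Prop} (hR : ∀ a b, R a b → R b a) {x y : α}
    (h : Relation.ReflTransGen R x y) : Relation.ReflTransGen R y x := by
  induction h with
  | refl => exact Relation.ReflTransGen.refl
  | tail _ hbc ih => exact Relation.ReflTransGen.head (hR _ _ hbc) ih

/-! ### ZZX-2  The chart pull-back of «an atom toward any direction» -/

/-- ★ A BARLOW STEP TOWARD ANY DIRECTION: at every site of a clean, globally charted `S` and for every `w ≠ 0` there is a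
Barlow neighbour `x'` with `0 < dist (Ψ x') (Ψ x) ≤ 17/16` and `∠(Ψ x' − Ψ x, w) ≤ 60°`. -/
theorem exists_barlowAdj_toward {S : Set E3} {Ψ : ℤ × ℤ × ℤ → E3} {τ : ℤ → Bool}
    (hΨ : IsBarlowBondChart S Set.univ Ψ τ) (hsurjΨ : ∀ p ∈ S, ∃ x, Ψ x = p)
    (hclean : ∀ p ∈ S, IsTwoShellGoodSet (1 / 16) (9 / 10) 1 S p) (x : ℤ × ℤ × ℤ) {w : E3} (hw : w ≠ 0) :
    ∃ x' : ℤ × ℤ × ℤ, BarlowAdj τ x x' ∧ 0 < dist (Ψ x') (Ψ x) ∧ dist (Ψ x') (Ψ x) ≤ 17 / 16 ∧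
      1 / 2 * (‖Ψ x' - Ψ x‖ * ‖w‖) ≤ ⟪Ψ x' - Ψ x, w⟫ := by
  have hxS : Ψ x ∈ S := hΨ.2.1 (Set.mem_univ x)
  obtain ⟨n, hnS, hpos, hle, hcone⟩ := exists_atom_toward (hclean _ hxS) hw
  obtain ⟨x', rfl⟩ := hsurjΨ n hnS
  refine ⟨x', ?_, hpos, by linarith, hcone⟩
  have hb : IsBond (Ψ x) (Ψ x') := ⟨by rwa [dist_comm], by rw [dist_comm]; linarith⟩
  exact (hΨ.2.2 x (Set.mem_univ _) x' (Set.mem_univ _)).1 hb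

/-! ### ZZX-3  Window membership and the potential -/

/-- potential in `(lo, hi)` ⇒ window membership. -/
theorem mem_window_of_infDist {S K : Set E3} {Ψ : ℤ × ℤ × ℤ → E3} {τ : ℤ → Bool}
    (hΨ : IsBarlowBondChart S Set.univ Ψ τ) (hKne : K.Nonempty) {lo hi : ℝ} {x : ℤ × ℤ × ℤ}
    (h1 : lo < Metric.infDist (Ψ x) K) (h2 : Metric.infDist (Ψ x) K < hi) : x ∈ window S K Ψ lo hi :=
  ⟨hΨ.2.1 (Set.mem_univ _), (Metric.infDist_lt_iff hKne).1 h2,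
    fun _ hy => lt_of_lt_of_le h1 (Metric.infDist_le_dist_of_mem hy)⟩

/-- window membership ⇒ potential in `(lo, hi)` (finite nonempty container). -/
theorem infDist_bounds_of_mem_window {S K : Set E3} {Ψ : ℤ × ℤ × ℤ → E3} (hKfin : K.Finite) (hKne : K.Nonempty)
    {lo hi : ℝ} {x : ℤ × ℤ × ℤ} (hx : x ∈ window S K Ψ lo hi) :
    lo < Metric.infDist (Ψ x) K ∧ Metric.infDist (Ψ x) K < hi := by
  obtain ⟨-, ⟨y, hy, hyd⟩, hfar⟩ := hx
  obtain ⟨k, hk, he⟩ := hKfin.isCompact.exists_infDist_eq_dist hKne (Ψ x)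
  exact ⟨by rw [he]; exact hfar k hk, (Metric.infDist_le_dist_of_mem hy).trans_lt hyd⟩

/-- a window site lies in the finite charted ball of radius `43/2` once `hi ≤ 43/2`. -/
theorem mem_ball_of_mem_window {S K : Set E3} {Ψ : ℤ × ℤ × ℤ → E3} {lo hi : ℝ} (hhi : hi ≤ 43 / 2)
    {x : ℤ × ℤ × ℤ} (hx : x ∈ window S K Ψ lo hi) : x ∈ {x : ℤ × ℤ × ℤ | ∃ k ∈ K, dist (Ψ x) k ≤ 43 / 2} := by
  obtain ⟨-, ⟨y, hy, hyd⟩, -⟩ := hx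
  exact ⟨y, hy, by linarith⟩

/-! ### ZZX-4  The inward cone step -/

/-- ★ INWARD CONE STEP: from radius `≥ 10` about `x₀`, a step of length `≤ 17/16` within `60°` of the direction to `x₀` strictly
decreases the distance to every point within `4` of `x₀`. -/
theorem dist_lt_dist_of_inward {p x₀ k n : E3} (hk : dist k x₀ ≤ 4) (hp : 10 ≤ dist p x₀)
    (hcone : 1 / 2 * (‖n - p‖ * ‖x₀ - p‖) ≤ ⟪n - p, x₀ - p⟫) (hpos : 0 < dist n p) (hlen : dist n p ≤ 17 / 16) :
    dist n k < dist p k := by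
  rw [dist_eq_norm] at hk hp hpos hlen
  rw [dist_eq_norm, dist_eq_norm]
  have hx : ‖x₀ - p‖ = ‖p - x₀‖ := norm_sub_rev _ _
  have hsq : ‖n - k‖ ^ 2 = ‖n - p‖ ^ 2 - 2 * ⟪n - p, k - p⟫ + ‖k - p‖ ^ 2 := by
    rw [← norm_sub_sq_real]; congr 1; abel
  have hsplit : ⟪n - p, k - p⟫ = ⟪n - p, x₀ - p⟫ + ⟪n - p, k - x₀⟫ := by
    rw [← inner_add_right]; congr 1; abel
  have hcs : |⟪n - p, k - x₀⟫| ≤ ‖n - p‖ * ‖k - x₀‖ := abs_real_inner_le_norm _ _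
  have hcs' : -(‖n - p‖ * 4) ≤ ⟪n - p, k - x₀⟫ := by
    have := neg_abs_le ⟪n - p, k - x₀⟫
    nlinarith [norm_nonneg (n - p)]
  have hinner : ‖n - p‖ ≤ ⟪n - p, k - p⟫ := by
    rw [hsplit]; rw [hx] at hcone; nlinarith [norm_nonneg (n - p)]
  have hlt : ‖n - k‖ ^ 2 < ‖k - p‖ ^ 2 := by rw [hsq]; nlinarith
  have := lt_of_pow_lt_pow_left₀ 2 (norm_nonneg _) hlt
  rwa [norm_sub_rev k p] at this

/-- ★ the potential STRICTLY DECREASES along an inward cone step (finite nonempty container), by at most the step length. -/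
theorem infDist_lt_infDist_of_inward {K : Set E3} {p x₀ n : E3} (hKfin : K.Finite) (hKne : K.Nonempty)
    (hK : ∀ k ∈ K, dist k x₀ ≤ 4) (hp : 10 ≤ dist p x₀)
    (hcone : 1 / 2 * (‖n - p‖ * ‖x₀ - p‖) ≤ ⟪n - p, x₀ - p⟫) (hpos : 0 < dist n p) (hlen : dist n p ≤ 17 / 16) :
    Metric.infDist n K < Metric.infDist p K ∧ Metric.infDist p K ≤ Metric.infDist n K + dist n p := by
  obtain ⟨k, hk, he⟩ := hKfin.isCompact.exists_infDist_eq_dist hKne p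
  refine ⟨?_, by rw [dist_comm]; exact Metric.infDist_le_infDist_add_dist⟩
  rw [he]
  exact (Metric.infDist_le_dist_of_mem hk).trans_lt (dist_lt_dist_of_inward (hK k hk) hp hcone hpos hlen)

/-- radius about `x₀` from the potential: `φ(p) − 4 ≤ ‖p − x₀‖`. -/
theorem infDist_sub_four_le_dist {K : Set E3} {p x₀ : E3} (hKne : K.Nonempty) (hK : ∀ k ∈ K, dist k x₀ ≤ 4) :
    Metric.infDist p K - 4 ≤ dist p x₀ := by
  obtain ⟨k, hk⟩ := hKne
  linarith [Metric.infDist_le_dist_of_mem (x := p) hk, dist_triangle p x₀ k, dist_comm x₀ k, hK k hk]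

/-! ### ZZX-5  Walks to the band `(M, M + 17/16]` -/

/-- UPWARD WALK: from a window site with potential `≤ M + 17/16`, a Barlow path inside the window to a site with potential in
`(M, M + 17/16]` (outward cone steps; the potential strictly increases, Part ZZT). -/
theorem exists_path_up {S K : Set E3} {Ψ : ℤ × ℤ × ℤ → E3} {τ : ℤ → Bool} {x₀ : E3}
    (hΨ : IsBarlowBondChart S Set.univ Ψ τ) (hsurjΨ : ∀ p ∈ S, ∃ x, Ψ x = p)
    (hclean : ∀ p ∈ S, IsTwoShellGoodSet (1 / 16) (9 / 10) 1 S p)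
    (hKfin : K.Finite) (hKne : K.Nonempty) (hK : ∀ k ∈ K, dist k x₀ ≤ 4)
    (hfin : Set.Finite {x : ℤ × ℤ × ℤ | ∃ k ∈ K, dist (Ψ x) k ≤ 43 / 2})
    {lo hi M : ℝ} (hlo : 8 ≤ lo) (hM : M + 17 / 16 < hi) (hhi : hi ≤ 43 / 2)
    {x : ℤ × ℤ × ℤ} (hx : x ∈ window S K Ψ lo hi) (hxM : Metric.infDist (Ψ x) K ≤ M + 17 / 16) :
    ∃ z ∈ window S K Ψ lo hi, M < Metric.infDist (Ψ z) K ∧ Metric.infDist (Ψ z) K ≤ M + 17 / 16 ∧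
      Relation.ReflTransGen (fun a b => a ∈ window S K Ψ lo hi ∧ b ∈ window S K Ψ lo hi ∧ BarlowAdj τ a b) x z := by
  classical
  have key := exists_path_to_goal
    (fun a b => a ∈ window S K Ψ lo hi ∧ b ∈ window S K Ψ lo hi ∧ BarlowAdj τ a b)
    {x | x ∈ window S K Ψ lo hi ∧ Metric.infDist (Ψ x) K ≤ M + 17 / 16}
    (fun x => M < Metric.infDist (Ψ x) K) (fun x => - Metric.infDist (Ψ x) K) hfin.toFinset
    (fun x hx => hfin.mem_toFinset.2 (mem_ball_of_mem_window hhi hx.1)) ?_ x ⟨hx, hxM⟩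
  · obtain ⟨z, hz, hgz, hpath⟩ := key
    exact ⟨z, hz.1, hgz, hz.2, hpath⟩
  rintro a ⟨ha, haM⟩ hga
  push Not at hga
  have hbd := infDist_bounds_of_mem_window hKfin hKne ha
  have hfar : ∀ k ∈ K, (8 : ℝ) < dist (Ψ a) k := fun k hk =>
    lt_of_lt_of_le (by linarith [hbd.1]) (Metric.infDist_le_dist_of_mem hk)
  have hw : Ψ a - x₀ ≠ 0 := by
    intro h
    have h0 : dist (Ψ a) x₀ = 0 := by rw [dist_eq_norm, h, norm_zero]
    linarith [infDist_sub_four_le_dist (p := Ψ a) hKne hK, hbd.1]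
  obtain ⟨a', hadj, hpos, hle, hcone⟩ := exists_barlowAdj_toward hΨ hsurjΨ hclean a hw
  have hmono := infDist_lt_infDist_of_cone hKfin hKne (by norm_num : (2 : ℝ) * 4 ≤ 8) hK hfar hcone hpos
  have h1 : lo < Metric.infDist (Ψ a') K := hbd.1.trans hmono.1
  have h2 : Metric.infDist (Ψ a') K ≤ M + 17 / 16 := by linarith [hmono.2]
  have ha' : a' ∈ window S K Ψ lo hi := mem_window_of_infDist hΨ hKne h1 (by linarith)
  exact ⟨a', ⟨ha', h2⟩, ⟨ha, ha', hadj⟩, by linarith [hmono.1]⟩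

/-- DOWNWARD WALK: from a window site with potential `> M` (`14 ≤ M`), a Barlow path inside the window to a site with potential in
`(M, M + 17/16]` (inward cone steps; the potential strictly decreases, ZZX-4). -/
theorem exists_path_down {S K : Set E3} {Ψ : ℤ × ℤ × ℤ → E3} {τ : ℤ → Bool} {x₀ : E3}
    (hΨ : IsBarlowBondChart S Set.univ Ψ τ) (hsurjΨ : ∀ p ∈ S, ∃ x, Ψ x = p)
    (hclean : ∀ p ∈ S, IsTwoShellGoodSet (1 / 16) (9 / 10) 1 S p)
    (hKfin : K.Finite) (hKne : K.Nonempty) (hK : ∀ k ∈ K, dist k x₀ ≤ 4)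
    (hfin : Set.Finite {x : ℤ × ℤ × ℤ | ∃ k ∈ K, dist (Ψ x) k ≤ 43 / 2})
    {lo hi M : ℝ} (hloM : lo ≤ M) (hM14 : 14 ≤ M) (hhi : hi ≤ 43 / 2)
    {x : ℤ × ℤ × ℤ} (hx : x ∈ window S K Ψ lo hi) (hxM : M < Metric.infDist (Ψ x) K) :
    ∃ z ∈ window S K Ψ lo hi, M < Metric.infDist (Ψ z) K ∧ Metric.infDist (Ψ z) K ≤ M + 17 / 16 ∧
      Relation.ReflTransGen (fun a b => a ∈ window S K Ψ lo hi ∧ b ∈ window S K Ψ lo hi ∧ BarlowAdj τ a b) x z := by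
  classical
  have key := exists_path_to_goal
    (fun a b => a ∈ window S K Ψ lo hi ∧ b ∈ window S K Ψ lo hi ∧ BarlowAdj τ a b)
    {x | x ∈ window S K Ψ lo hi ∧ M < Metric.infDist (Ψ x) K}
    (fun x => Metric.infDist (Ψ x) K ≤ M + 17 / 16) (fun x => Metric.infDist (Ψ x) K) hfin.toFinset
    (fun x hx => hfin.mem_toFinset.2 (mem_ball_of_mem_window hhi hx.1)) ?_ x ⟨hx, hxM⟩
  · obtain ⟨z, hz, hgz, hpath⟩ := key
    exact ⟨z, hz.1, hz.2, hgz, hpath⟩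
  rintro a ⟨ha, haM⟩ hga
  push Not at hga
  have hbd := infDist_bounds_of_mem_window hKfin hKne ha
  have hrad : 10 ≤ dist (Ψ a) x₀ := by linarith [infDist_sub_four_le_dist (p := Ψ a) hKne hK]
  have hw : x₀ - Ψ a ≠ 0 := by
    intro h
    have h0 : dist (Ψ a) x₀ = 0 := by rw [dist_comm, dist_eq_norm, h, norm_zero]
    linarith
  obtain ⟨a', hadj, hpos, hle, hcone⟩ := exists_barlowAdj_toward hΨ hsurjΨ hclean a hw
  have hmono := infDist_lt_infDist_of_inward hKfin hKne hK hrad hcone hpos hle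
  have h1 : M < Metric.infDist (Ψ a') K := by linarith [hmono.2]
  have h2 : Metric.infDist (Ψ a') K < hi := hmono.1.trans hbd.2
  have ha' : a' ∈ window S K Ψ lo hi := mem_window_of_infDist hΨ hKne (lt_of_le_of_lt hloM h1) h2
  exact ⟨a', ⟨ha', h1⟩, ⟨ha, ha', hadj⟩, hmono.1⟩

/-- ★ WALK TO THE BAND: from ANY site of the window `(lo, hi)` a Barlow path inside the window to a site with potential in
`(M, M + 17/16]`, for a band dial `M` with `8 ≤ lo ≤ M`, `14 ≤ M`, `M + 17/16 < hi ≤ 43/2`. -/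
theorem exists_path_to_band {S K : Set E3} {Ψ : ℤ × ℤ × ℤ → E3} {τ : ℤ → Bool} {x₀ : E3}
    (hΨ : IsBarlowBondChart S Set.univ Ψ τ) (hsurjΨ : ∀ p ∈ S, ∃ x, Ψ x = p)
    (hclean : ∀ p ∈ S, IsTwoShellGoodSet (1 / 16) (9 / 10) 1 S p)
    (hKfin : K.Finite) (hKne : K.Nonempty) (hK : ∀ k ∈ K, dist k x₀ ≤ 4)
    (hfin : Set.Finite {x : ℤ × ℤ × ℤ | ∃ k ∈ K, dist (Ψ x) k ≤ 43 / 2})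
    {lo hi M : ℝ} (hlo : 8 ≤ lo) (hloM : lo ≤ M) (hM14 : 14 ≤ M) (hM : M + 17 / 16 < hi) (hhi : hi ≤ 43 / 2)
    {x : ℤ × ℤ × ℤ} (hx : x ∈ window S K Ψ lo hi) :
    ∃ z ∈ window S K Ψ lo hi, M < Metric.infDist (Ψ z) K ∧ Metric.infDist (Ψ z) K ≤ M + 17 / 16 ∧
      Relation.ReflTransGen (fun a b => a ∈ window S K Ψ lo hi ∧ b ∈ window S K Ψ lo hi ∧ BarlowAdj τ a b) x z := by
  by_cases h : Metric.infDist (Ψ x) K ≤ M + 17 / 16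
  · exact exists_path_up hΨ hsurjΨ hclean hKfin hKne hK hfin hlo hM hhi hx h
  · push Not at h
    exact exists_path_down hΨ hsurjΨ hclean hKfin hKne hK hfin hloM hM14 hhi hx (by linarith)

/-! ### ZZX-6  The greedy walk toward a point -/

/-- the greedy step: a cone step of length `< ‖t − p‖` toward `t` strictly decreases the distance to `t`. -/
theorem dist_lt_of_toward {p n t : E3} (hcone : 1 / 2 * (‖n - p‖ * ‖t - p‖) ≤ ⟪n - p, t - p⟫)
    (hpos : 0 < dist n p) (hlt : dist n p < dist p t) : dist n t < dist p t := by
  rw [dist_eq_norm] at hpos hlt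
  rw [dist_eq_norm, dist_eq_norm, norm_sub_rev p t] at *
  have hsq : ‖n - t‖ ^ 2 = ‖n - p‖ ^ 2 - 2 * ⟪n - p, t - p⟫ + ‖t - p‖ ^ 2 := by
    rw [← norm_sub_sq_real]; congr 1; abel
  have h : ‖n - t‖ ^ 2 < ‖t - p‖ ^ 2 := by rw [hsq]; nlinarith
  exact lt_of_pow_lt_pow_left₀ 2 (norm_nonneg _) h

/-- ★ GREEDY WALK TOWARD A POINT: from a window site within `L` of a point `t` whose potential satisfies `lo + L ≤ φ(t)` and
`φ(t) + L ≤ hi ≤ 43/2`, a Barlow path INSIDE the window to a site within `17/16` of `t`; every site of the path is within `L` of `t`. -/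
theorem exists_path_toward_point {S K : Set E3} {Ψ : ℤ × ℤ × ℤ → E3} {τ : ℤ → Bool}
    (hΨ : IsBarlowBondChart S Set.univ Ψ τ) (hsurjΨ : ∀ p ∈ S, ∃ x, Ψ x = p)
    (hclean : ∀ p ∈ S, IsTwoShellGoodSet (1 / 16) (9 / 10) 1 S p) (hKne : K.Nonempty)
    (hfin : Set.Finite {x : ℤ × ℤ × ℤ | ∃ k ∈ K, dist (Ψ x) k ≤ 43 / 2})
    {lo hi L : ℝ} {t : E3} (hlo : lo + L ≤ Metric.infDist t K) (hhiL : Metric.infDist t K + L ≤ hi) (hhi : hi ≤ 43 / 2)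
    {x : ℤ × ℤ × ℤ} (hx : x ∈ window S K Ψ lo hi) (hxt : dist (Ψ x) t ≤ L) :
    ∃ z ∈ window S K Ψ lo hi, dist (Ψ z) t ≤ 17 / 16 ∧
      Relation.ReflTransGen (fun a b => a ∈ window S K Ψ lo hi ∧ b ∈ window S K Ψ lo hi ∧ BarlowAdj τ a b) x z := by
  classical
  have key := exists_path_to_goal
    (fun a b => a ∈ window S K Ψ lo hi ∧ b ∈ window S K Ψ lo hi ∧ BarlowAdj τ a b)
    {x | x ∈ window S K Ψ lo hi ∧ dist (Ψ x) t ≤ L}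
    (fun x => dist (Ψ x) t ≤ 17 / 16) (fun x => dist (Ψ x) t) hfin.toFinset
    (fun x hx => hfin.mem_toFinset.2 (mem_ball_of_mem_window hhi hx.1)) ?_ x ⟨hx, hxt⟩
  · obtain ⟨z, hz, hgz, hpath⟩ := key
    exact ⟨z, hz.1, hgz, hpath⟩
  rintro a ⟨ha, haL⟩ hga
  push Not at hga
  have hw : t - Ψ a ≠ 0 := by
    intro h
    have : dist (Ψ a) t = 0 := by rw [dist_comm, dist_eq_norm, h, norm_zero]
    linarith
  obtain ⟨a', hadj, hpos, hle, hcone⟩ := exists_barlowAdj_toward hΨ hsurjΨ hclean a hw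
  have hdec : dist (Ψ a') t < dist (Ψ a) t := dist_lt_of_toward hcone hpos (by linarith)
  have h1 : lo < Metric.infDist (Ψ a') K := by
    have := Metric.infDist_le_infDist_add_dist (s := K) (x := t) (y := Ψ a')
    rw [dist_comm] at this
    linarith
  have h2 : Metric.infDist (Ψ a') K < hi := by
    have := Metric.infDist_le_infDist_add_dist (s := K) (x := Ψ a') (y := t)
    linarith
  have ha' : a' ∈ window S K Ψ lo hi := mem_window_of_infDist hΨ hKne h1 h2
  exact ⟨a', ⟨ha', by linarith⟩, ⟨ha, ha', hadj⟩, hdec⟩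

/-- the last hop: a window site whose atom is within `17/16` of the atom of another site is that site or a Barlow neighbour of it. -/
theorem reflTransGen_of_dist_le {S K : Set E3} {Ψ : ℤ × ℤ × ℤ → E3} {τ : ℤ → Bool}
    (hΨ : IsBarlowBondChart S Set.univ Ψ τ) {lo hi : ℝ} {z x : ℤ × ℤ × ℤ}
    (hz : z ∈ window S K Ψ lo hi) (hx : x ∈ window S K Ψ lo hi) (hd : dist (Ψ z) (Ψ x) ≤ 17 / 16) :
    Relation.ReflTransGen (fun a b => a ∈ window S K Ψ lo hi ∧ b ∈ window S K Ψ lo hi ∧ BarlowAdj τ a b) z x := by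
  by_cases h : Ψ z = Ψ x
  · rw [hΨ.1 (Set.mem_univ _) (Set.mem_univ _) h]
  · have hb : IsBond (Ψ z) (Ψ x) := ⟨dist_pos.2 h, by linarith⟩
    exact Relation.ReflTransGen.single ⟨hz, hx, (hΨ.2.2 z (Set.mem_univ _) x (Set.mem_univ _)).1 hb⟩

end Summit.AtomisticToContinuum.Crystallization.Theorems.ChartedZeroExcessLayeredLatticeLiouville

end
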